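import Summits.AtomisticToContinuum.HydrodynamicLimit.Theorems.JParityClosureParityBandClosureEnergyFloorIntegrated
import HarnessLib

/-!
# Line `entropy-floor-fixes-energy` (crux `JParityClosure.ParityBandClosure`, stmt-AtomisticToContinuum-17608),
# stub `stub_energyFloorOfEntropyFloor` — part 3: the PATHWISE chain for one configuration

Deterministic core of the probabilistic assembly (part 4): for ONE configuration `w` of `N + 1` particles with pairwise
distinct velocities, read at the instant against the classical fields `(ρ̃, ũ, θ̃)(t, ·)`, IF the kinetic energy per
particle is `≤ K_E`, the mollified density overshoots `ρ̃` by at most `η_E/4` (so `ρ_rσ³` lies in the analytic band and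
cold cells are priced by `cold_cell_density_le` + `cold_threshold` once `N` is large), the entropy dip is `≥ −η₁`, the
`L¹` density error is `≤ η₂`, the three `χũ_k`-tested momentum deviations are `≤ δ_m`, and the tolerances are tied to `δ`
as in part 4, THEN `⟨E_N, χ⟩ ≥ ∫χẼ − δ` (`pathwise_energy_floor`): `integrated_energy_floor` + the floor + the `L¹` cap
+ `abs_momentum_term_le` per component + the energy commutator `abs_empiricalEnergyField_sub_integral_mul_le`.
No probability, no named fact.
-/

noncomputable section

namespace Summit.AtomisticToContinuum.HydrodynamicLimit.Theorems.ParityBandClosureEnergyFloor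

open scoped BigOperators Topology Classical MeasureTheory ENNReal InnerProductSpace
open Filter Set MeasureTheory
open Literature.MathematicalPhysics.KineticTheory
open Literature.Analysis.FluidPDE
open Literature.Analysis.FunctionSpaces
open Summit.AtomisticToContinuum.HydrodynamicLimit.Theorems.DensityCapNegative
  (cone cone_nonneg cone_le mollDensity_eq mollDensity_nonneg)
open Summit.AtomisticToContinuum.HydrodynamicLimit.Theorems.KineticClosureBridge
  (continuous_mollMomentum continuous_mollEnergy abs_empiricalEnergyField_sub_integral_mul_le meanSpeed_le meanEnergy_eq)

/-- **The pathwise chain** (see the module docstring; every hypothesis is what part 4 reads off the complement of its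
eight bad events, plus the `r`-independent constants and tolerances). [folklore] -/
theorem pathwise_energy_floor {N : ℕ} (w : Config (N + 1) (Fin 3) T3)
    {σ r ηE B L K₀ KE θmin δ κE κm κχ κu Cχ Cu η₁ η₂ δm : ℝ} {χ ρt θt : T3 → ℝ} {ut : T3 → V3}
    (hσ : 0 < σ) (hσ3 : σ ^ 3 ≤ 1) (hr : 0 < r) (hrhalf : r ≤ 1 / 2) (hηE : 0 < ηE)
    (hχ : Continuous χ) (hρt : Continuous ρt) (hθt : Continuous θt) (hut : Continuous ut)
    (hχ0 : ∀ x, 0 ≤ χ x) (hρpos : ∀ x, 0 < ρt x) (hθpos : ∀ x, 0 < θt x)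
    (hfc : ContinuousOn hsExcessFreeEnergy (Set.Icc 0 (ηE / 2)))
    (hB : ∀ a ∈ Set.Icc (0 : ℝ) (ηE / 2), |hsExcessFreeEnergy a| ≤ B)
    (hL : ∀ a ∈ Set.Icc (0 : ℝ) (ηE / 2), ∀ b ∈ Set.Icc (0 : ℝ) (ηE / 2),
      |hsExcessFreeEnergy a - hsExcessFreeEnergy b| ≤ L * |a - b|)
    (hθmin : 0 < θmin) (hθmin_le : ∀ x, θmin ≤ θt x) (hρt4 : ∀ x, ρt x * σ ^ 3 ≤ ηE / 4)
    (hvel : ∀ i j : Fin (N + 1), i ≠ j → (w i).2 ≠ (w j).2)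
    (hEn : ((N : ℝ) + 1)⁻¹ * configEnergy w ≤ KE)
    (hcap : ∀ x, DensityCapNegative.mollDensity r w x ≤ ρt x + ηE / 4)
    (hρstarN : ((N + 1 : ℕ) : ℝ)⁻¹ * (3 / (Real.pi * r ^ 3)) ≤ Real.exp (3 / 2 * Real.log θmin - 3 / 2 - B))
    (hint : (∀ x, DensityCapNegative.mollDensity r w x * σ ^ 3 ≤ ηE / 2) →
      Integrable (fun x : T3 => LocalSecondLawNegative.Hs σ (DensityCapNegative.mollDensity r w x)
        (2 / 3 * (empiricalEnergyField w (fun y => cone r y x) / DensityCapNegative.mollDensity r w x -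
          ‖empiricalMomentumField w (fun y => cone r y x)‖ ^ 2 / (2 * DensityCapNegative.mollDensity r w x ^ 2)))))
    (hK₀0 : 0 ≤ K₀)
    (hK : ∀ x, χ x * (θt x * (3 / 2 * |Real.log (θt x)| + |Real.log (ρt x)| + 1 + B + ρt x * σ ^ 3 * L) +
      3 / 2 * θt x + ‖ut x‖ ^ 2 / 2) ≤ K₀)
    (hfloor : -η₁ ≤ ∫ x : T3, χ x * θt x * (LocalSecondLawNegative.Hs σ (ρt x) (θt x) -
      LocalSecondLawNegative.Hs σ (DensityCapNegative.mollDensity r w x)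
        (2 / 3 * (empiricalEnergyField w (fun y => cone r y x) / DensityCapNegative.mollDensity r w x -
          ‖empiricalMomentumField w (fun y => cone r y x)‖ ^ 2 / (2 * DensityCapNegative.mollDensity r w x ^ 2)))))
    (hL1 : ∫ x, |DensityCapNegative.mollDensity r w x - ρt x| ≤ η₂)
    (hmodE : ∀ x y, Torus.euclidDist x y < r → |χ x - χ y| ≤ κE)
    (hmodχ : ∀ x y, Torus.euclidDist x y < r → |χ x - χ y| ≤ κχ)
    (hmodu : ∀ x y, Torus.euclidDist x y < r → ‖ut x - ut y‖ ≤ κu)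
    (hCχ0 : 0 ≤ Cχ) (hCχ : ∀ x, |χ x| ≤ Cχ) (hCu : ∀ x, ‖ut x‖ ≤ Cu)
    (hdev : ∀ k : Fin 3, ‖empiricalMomentumField w (fun x => χ x * ut x k) - ∫ x, ((χ x * ut x k) * ρt x) • ut x‖ ≤ δm)
    (hκE0 : 0 ≤ κE) (hκm0 : 0 ≤ κm) (hη₁ : η₁ ≤ δ / 8) (hden' : K₀ * η₂ ≤ δ / 8) (hκE' : κE * KE ≤ δ / 8)
    (hκm' : 3 * (κm * (1 / 2 + KE) + δm) ≤ δ / 4) (hκχ' : κχ * Cu ≤ κm / 2) (hκu' : Cχ * κu ≤ κm / 2) :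
    (∫ x, χ x * totalEnergyDensity (ρt x) (ut x) (θt x)) - δ ≤ empiricalEnergyField w χ := by
  have hn : N + 1 ≠ 0 := Nat.succ_ne_zero N
  have hnR : (0 : ℝ) < ((N + 1 : ℕ) : ℝ) := by positivity
  have hNinv : ((N + 1 : ℕ) : ℝ)⁻¹ = ((N : ℝ) + 1)⁻¹ := by push_cast; ring
  -- the band
  have hρb : ∀ x, DensityCapNegative.mollDensity r w x * σ ^ 3 ≤ ηE / 2 := by
    intro x
    have h1 : DensityCapNegative.mollDensity r w x * σ ^ 3 ≤ (ρt x + ηE / 4) * σ ^ 3 :=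
      mul_le_mul_of_nonneg_right (hcap x) (pow_nonneg hσ.le 3)
    have h2 : ηE / 4 * σ ^ 3 ≤ ηE / 4 := mul_le_of_le_one_right (by positivity) hσ3
    have h3 := hρt4 x
    nlinarith
  have hρtb : ∀ x, ρt x * σ ^ 3 ≤ ηE / 2 := fun x => by linarith [hρt4 x]
  -- the cold-cell side condition
  have hJ : ∀ x, 2 / 3 * (empiricalEnergyField w (fun y => cone r y x) / DensityCapNegative.mollDensity r w x -
      ‖empiricalMomentumField w (fun y => cone r y x)‖ ^ 2 / (2 * DensityCapNegative.mollDensity r w x ^ 2)) ≤ 0 →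
      0 < DensityCapNegative.mollDensity r w x →
      3 / 2 * DensityCapNegative.mollDensity r w x ≤ DensityCapNegative.mollDensity r w x *
        (3 / 2 * Real.log (θt x) - Real.log (DensityCapNegative.mollDensity r w x) -
          hsExcessFreeEnergy (DensityCapNegative.mollDensity r w x * σ ^ 3)) := by
    intro x hθle hρpos'
    have hcold := cold_cell_density_le hr w hvel x hρpos' (two_mul_mul_sub_le_zero_of_theta_nonpos hρpos' hθle)
    exact cold_threshold hθmin (hθmin_le x)
      (hB _ ⟨mul_nonneg (mollDensity_nonneg hr w x) (pow_nonneg hσ.le 3), hρb x⟩) hρpos' (hcold.trans hρstarN)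
  -- the integrated squeeze
  have hineq := integrated_energy_floor hn hσ.le hr w hχ hρt hθt hut hχ0 hρpos hθpos hfc hB hL hρb hρtb hJ (hint hρb) hK
  -- the `L¹` density term
  have hden : K₀ * ∫ x, |DensityCapNegative.mollDensity r w x - ρt x| ≤ δ / 8 :=
    (mul_le_mul_of_nonneg_left hL1 hK₀0).trans hden'
  -- the momentum term, componentwise
  have hspeed : ((N + 1 : ℕ) : ℝ)⁻¹ * ∑ i, ‖(w i).2‖ ≤ 1 / 2 + KE := by
    refine (meanSpeed_le w).trans ?_
    rw [hNinv]
    linarith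
  have hmodk : ∀ k : Fin 3, ∀ x y, Torus.euclidDist x y < r → |χ x * ut x k - χ y * ut y k| ≤ κm := by
    intro k x y hxy
    have h1 : |χ x - χ y| ≤ κχ := hmodχ x y hxy
    have h3 : |ut x k| ≤ Cu := by
      rw [← Real.norm_eq_abs]
      exact (PiLp.norm_apply_le (ut x) k).trans (hCu x)
    have h4 : |ut x k - ut y k| ≤ κu := by
      rw [← Real.norm_eq_abs, ← PiLp.sub_apply]
      exact (PiLp.norm_apply_le (ut x - ut y) k).trans (hmodu x y hxy)
    have h5 : |χ y| ≤ Cχ := hCχ y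
    have e : χ x * ut x k - χ y * ut y k = (χ x - χ y) * ut x k + χ y * (ut x k - ut y k) := by ring
    rw [e]
    have hCu0 : 0 ≤ Cu := (norm_nonneg _).trans (hCu x)
    calc |(χ x - χ y) * ut x k + χ y * (ut x k - ut y k)|
        ≤ |χ x - χ y| * |ut x k| + |χ y| * |ut x k - ut y k| := by
          refine (abs_add_le _ _).trans ?_
          rw [abs_mul, abs_mul]
      _ ≤ κχ * Cu + Cχ * κu :=
          add_le_add (mul_le_mul h1 h3 (abs_nonneg _) ((abs_nonneg _).trans h1))
            (mul_le_mul h5 h4 (abs_nonneg _) hCχ0)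
      _ ≤ κm := by linarith
  have hmomk : ∀ k : Fin 3, |∫ x, χ x * ut x k * (empiricalMomentumField w (fun y => cone r y x) - ρt x • ut x) k| ≤
      κm * (1 / 2 + KE) + δm := fun k =>
    abs_momentum_term_le w hr hrhalf hχ hρt hut k (hmodk k) hspeed hκm0 (hdev k)
  have hmom : |∫ x, χ x * ⟪ut x, empiricalMomentumField w (fun y => cone r y x) - ρt x • ut x⟫_ℝ| ≤ δ / 4 := by
    have hXc : Continuous fun x => empiricalMomentumField w (fun y => cone r y x) - ρt x • ut x :=
      (continuous_mollMomentum r w).sub (hρt.smul hut)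
    rw [integral_inner_eq_sum (X := fun x => empiricalMomentumField w (fun y => cone r y x) - ρt x • ut x) hχ hut hXc]
    refine (Finset.abs_sum_le_sum_abs _ _).trans ?_
    calc ∑ k : Fin 3, |∫ x, χ x * ut x k * (empiricalMomentumField w (fun y => cone r y x) - ρt x • ut x) k|
        ≤ ∑ _k : Fin 3, (κm * (1 / 2 + KE) + δm) := Finset.sum_le_sum fun k _ => hmomk k
      _ = 3 * (κm * (1 / 2 + KE) + δm) := by
          rw [Finset.sum_const, Finset.card_univ, Fintype.card_fin, nsmul_eq_mul]; norm_num
      _ ≤ δ / 4 := hκm'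
  -- the energy commutator
  have hcomm : |empiricalEnergyField w χ - ∫ x, χ x * empiricalEnergyField w (fun y => cone r y x)| ≤ δ / 8 := by
    calc _ ≤ κE * (((N + 1 : ℕ) : ℝ)⁻¹ * ∑ i, ‖(w i).2‖ ^ 2 / 2) :=
          abs_empiricalEnergyField_sub_integral_mul_le hr hrhalf hχ hmodE w
      _ ≤ κE * KE := by
          refine mul_le_mul_of_nonneg_left ?_ hκE0
          rw [meanEnergy_eq, hNinv]
          exact hEn
      _ ≤ δ / 8 := hκE'
  -- assemble
  rw [abs_le] at hcomm hmom
  linarith [hineq, hfloor, hden, hmom.1, hmom.2, hcomm.1, hcomm.2]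

/-- A scale below three thresholds, three moduli radii and `1/2` — the order of choices puts `r` after every tolerance.
[folklore] -/
theorem exists_scale7 {a b c d e f : ℝ} (ha : 0 < a) (hb : 0 < b) (hc : 0 < c) (hd : 0 < d) (he : 0 < e) (hf : 0 < f) :
    ∃ r : ℝ, 0 < r ∧ r < a ∧ r < b ∧ r < c ∧ r ≤ d ∧ r ≤ e ∧ r ≤ f ∧ r ≤ 1 / 2 := by
  refine ⟨min (min a (min b c)) (min (min d e) (min f (1 / 2))) / 2, by positivity, ?_, ?_, ?_, ?_, ?_, ?_, ?_⟩ <;>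
  · have h1 := min_le_left (min a (min b c)) (min (min d e) (min f (1 / 2)))
    have h2 := min_le_right (min a (min b c)) (min (min d e) (min f (1 / 2)))
    have h3 := min_le_left a (min b c)
    have h4 := min_le_right a (min b c)
    have h5 := min_le_left b c
    have h6 := min_le_right b c
    have h7 := min_le_left (min d e) (min f (1 / 2))
    have h8 := min_le_right (min d e) (min f (1 / 2))
    have h9 := min_le_left d e
    have h10 := min_le_right d e
    have h11 := min_le_left f (1 / 2 : ℝ)
    have h12 := min_le_right f (1 / 2 : ℝ)
    have h0 : 0 < min (min a (min b c)) (min (min d e) (min f (1 / 2))) := by positivity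
    linarith

/-- **Registered sub-goal** (helper 3/4 of `stub_energyFloorOfEntropyFloor`): the choice of the scale. [folklore] -/
theorem stub_energyFloorScale : ∀ {a b c d e f : ℝ}, 0 < a → 0 < b → 0 < c → 0 < d → 0 < e → 0 < f → ∃ r : ℝ, 0 < r ∧ r < a ∧ r < b ∧ r < c ∧ r ≤ d ∧ r ≤ e ∧ r ≤ f ∧ r ≤ 1 / 2 :=
  fun ha hb hc hd he hf => exists_scale7 ha hb hc hd he hf

end Summit.AtomisticToContinuum.HydrodynamicLimit.Theorems.ParityBandClosureEnergyFloor

end
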